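import Literature.Analysis.FluidPDE.PassiveVectorGalerkin
import HarnessLib

/-!
# The Fourier–Galerkin field of the passive solenoidal vector around Kolmogorov layers: ladder form

Analysis/FluidPDE proof-support file (theorems only; no definitions, no named facts). The passive-vector Galerkin
field `Torus.pvGalerkinField κ S β c k = -κ4π²|k|² c k - Π_k convectionCoeff S β c k` (`PassiveVectorGalerkin`) is
computed for a carrier made of KOLMOGOROV LAYERS — coefficient families supported on a pair of opposite frequencies
`±K` and polarised along a fixed vector `e ⊥ K`, `β(K) = a • e`, `β(-K) = a' • e` (the Fourier form of one frozen shear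
layer `sin(2π K·x + φ) ê`, Meshalkin–Sinai 1961; the slots of the lattice shear words of `LatticeShearWords`):

* §1 **one layer**: mode `k` is fed only by the modes `k ∓ K`, through the SAME scalar factor `2πi (e·k)`:
  `convectionCoeff S β c k = (2πi ∑ⱼ eⱼ kⱼ) • (a • c(k-K) + a' • c(k+K))` and
  `pvGalerkinField κ S β c k = -κ4π²|k|² c k - (2πi ∑ⱼ eⱼ kⱼ) • Π_k (a • c(k-K) + a' • c(k+K))`
  (Meshalkin–Sinai's three-term recursion / continued-fraction structure of the Kolmogorov-flow linearisation,
  here for the passive vector with the Leray symbol `Π_k`);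
* §2 **superposition**: the convection symbol is additive and homogeneous in the carrier, so a finite real
  combination of layers (a lattice-word cell carrier at a fixed time) gives the sum of the layer ladders;
* §3 **cosets**: along a coset `k₀ + ℤK` the factor `e·k` is constant (`e ⊥ K`), so each coset carries a
  tridiagonal LADDER system;
* §4 **out-of-plane decoupling**: for a direction `ζ` transversal to `k` the Leray symbol is invisible
  (`⟪ζ, Π_k w⟫ = ⟪ζ, w⟫`), so the components `⟪ζ, c k⟫` along a vector `ζ ⊥ span(k₀, K)` obey the exact SCALAR ladder.

These are the structural identities behind the Bloch-sector analysis of crux K2R `RealisedQuasiStaticCellLaw`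
(cell `ad-ideate`, STUB-PLAN `stub_lowSectorDecay` §1 «standard ladder of slot j»).

## References

* L. D. Meshalkin, Ia. G. Sinai, *Investigation of the stability of a stationary solution of a system of equations
  for the plane movement of an incompressible viscous liquid*, J. Appl. Math. Mech. 25 (1961) 1700–1705
  (three-term recursion for the Kolmogorov flow). [`MeshalkinSinai1961`]
* P. Constantin, C. Foias, *Navier–Stokes Equations* (Chicago 1988), Ch. 8, (8.5) (Galerkin convolution structure).
  [`ConstantinFoias1988`]
-/

open Finset
open scoped InnerProductSpace ComplexConjugate

noncomputable section

namespace Literature.Analysis.FluidPDE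

namespace Torus

open FunctionSpaces.Torus FunctionSpaces

variable {d : Type*} [Fintype d]

/-! ## §1 One Kolmogorov layer -/

section Layer

variable {S : Finset (d → ℤ)} {K : d → ℤ} {e : EuclideanSpace ℂ d} {a a' : ℂ}

omit [Fintype d] in
/-- A non-zero lattice frequency is not its own opposite. [folklore] -/
private theorem ne_neg_of_ne_zero (hK : K ≠ 0) : K ≠ -K := by
  intro h
  apply hK
  funext i
  have hi := congrFun h i
  simp only [Pi.neg_apply] at hi
  have : K i = 0 := by omega
  simpa using this

/-- The layer coefficient family evaluated at `K`. [cite: MeshalkinSinai1961, pp. 1700–1705] -/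
theorem layerCoeff_apply_self (hK : K ≠ 0) (e : EuclideanSpace ℂ d) (a a' : ℂ) :
    (((if K = K then a else 0) + (if K = -K then a' else 0)) • e : EuclideanSpace ℂ d) = a • e := by
  simp only [if_true, if_neg (ne_neg_of_ne_zero hK), add_zero]

/-- The layer coefficient family evaluated at `-K`. [cite: MeshalkinSinai1961, pp. 1700–1705] -/
theorem layerCoeff_apply_neg (hK : K ≠ 0) (e : EuclideanSpace ℂ d) (a a' : ℂ) :
    (((if -K = K then a else 0) + (if -K = -K then a' else 0)) • e : EuclideanSpace ℂ d) = a' • e := by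
  have h : -K ≠ K := fun h => ne_neg_of_ne_zero hK h.symm
  simp only [if_neg h, if_true, zero_add]

/-- The layer coefficient family vanishes off `±K`. [cite: MeshalkinSinai1961, pp. 1700–1705] -/
theorem layerCoeff_apply_of_ne {l : d → ℤ} (hl : l ≠ K) (hl' : l ≠ -K) (e : EuclideanSpace ℂ d) (a a' : ℂ) :
    (((if l = K then a else 0) + (if l = -K then a' else 0)) • e : EuclideanSpace ℂ d) = 0 := by
  simp only [if_neg hl, if_neg hl', add_zero, zero_smul]

/-- The transversality factor of a translate: `∑ⱼ (a e)ⱼ (k - l)ⱼ = a ∑ⱼ eⱼ kⱼ` when `e ⊥ l`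
(`∑ⱼ lⱼ eⱼ = 0`). [folklore] -/
private theorem sum_smul_mul_sub_eq (he : ∑ j, (K j : ℂ) * e j = 0) (a : ℂ) (k : d → ℤ) :
    ∑ j, (a • e) j * ((k - K) j : ℂ) = a * ∑ j, e j * (k j : ℂ) := by
  have h1 : ∑ j, (a • e) j * ((k - K) j : ℂ) = a * ∑ j, e j * (k j : ℂ) - a * ∑ j, (K j : ℂ) * e j := by
    rw [Finset.mul_sum, Finset.mul_sum, ← Finset.sum_sub_distrib]
    refine Finset.sum_congr rfl fun j _ => ?_
    simp only [PiLp.smul_apply, smul_eq_mul, Pi.sub_apply, Int.cast_sub]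
    ring
  rw [h1, he, mul_zero, sub_zero]

/-- Same for the opposite frequency: `∑ⱼ (a' e)ⱼ (k + K)ⱼ = a' ∑ⱼ eⱼ kⱼ` when `e ⊥ K`. [folklore] -/
private theorem sum_smul_mul_add_eq (he : ∑ j, (K j : ℂ) * e j = 0) (a' : ℂ) (k : d → ℤ) :
    ∑ j, (a' • e) j * ((k + K) j : ℂ) = a' * ∑ j, e j * (k j : ℂ) := by
  have h1 : ∑ j, (a' • e) j * ((k + K) j : ℂ) = a' * ∑ j, e j * (k j : ℂ) + a' * ∑ j, (K j : ℂ) * e j := by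
    rw [Finset.mul_sum, Finset.mul_sum, ← Finset.sum_add_distrib]
    refine Finset.sum_congr rfl fun j _ => ?_
    simp only [PiLp.smul_apply, smul_eq_mul, Pi.add_apply, Int.cast_add]
    ring
  rw [h1, he, mul_zero, add_zero]

/-- One row of the convection symbol: the contribution of a fixed carrier frequency `l` is
`[k - l ∈ S] (2πi β(l)·(k - l)) • c(k - l)`. [cite: ConstantinFoias1988, Ch. 8 (8.5)] -/
theorem sum_ite_convection_row (β c : (d → ℤ) → EuclideanSpace ℂ d) (l k : d → ℤ) :
    (∑ m ∈ S, if l + m = k then (2 * Real.pi * Complex.I * ∑ j, β l j * (m j : ℂ)) • c m else 0) =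
      if k - l ∈ S then (2 * Real.pi * Complex.I * ∑ j, β l j * ((k - l) j : ℂ)) • c (k - l) else 0 := by
  have hiff : ∀ m, (l + m = k) ↔ (m = k - l) := fun m =>
    ⟨fun hm => by rw [← hm]; abel, fun hm => by rw [hm]; abel⟩
  simp_rw [hiff]
  exact Finset.sum_ite_eq' S (k - l) _

/-- **The convection symbol of one Kolmogorov layer** (carrier coefficients `a • e` at `K`, `a' • e` at `-K`,
`e ⊥ K`, `K ≠ 0`, `±K ∈ S`), acting on a state `c` vanishing off `S`: mode `k` is fed only by `k ∓ K`, with the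
common factor `2πi (e·k)`:
`convectionCoeff S β c k = (2πi ∑ⱼ eⱼ kⱼ) • (a • c(k - K) + a' • c(k + K))`. [cite: MeshalkinSinai1961, pp. 1700–1705] -/
theorem convectionCoeff_layer (hK : K ≠ 0) (hKS : K ∈ S) (hKS' : -K ∈ S) (he : ∑ j, (K j : ℂ) * e j = 0)
    (a a' : ℂ) {c : (d → ℤ) → EuclideanSpace ℂ d} (hc : ∀ m, m ∉ S → c m = 0) (k : d → ℤ) :
    convectionCoeff S (fun l => ((if l = K then a else 0) + (if l = -K then a' else 0)) • e) c k =
      (2 * Real.pi * Complex.I * ∑ j, e j * (k j : ℂ)) • (a • c (k - K) + a' • c (k + K)) := by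
  have hKK : K ≠ -K := ne_neg_of_ne_zero hK
  rw [convectionCoeff_def, Finset.sum_congr rfl fun l _ => sum_ite_convection_row
    (fun l : d → ℤ => ((if l = K then a else 0) + (if l = -K then a' else 0)) • e) c l k]
  rw [Finset.sum_eq_add_of_mem K (-K) hKS hKS' hKK]
  · rw [layerCoeff_apply_self hK, layerCoeff_apply_neg hK, sum_smul_mul_sub_eq he, sub_neg_eq_add,
      sum_smul_mul_add_eq he]
    -- the two translates, present or absent from `S`
    have h1 : (if k - K ∈ S then (2 * Real.pi * Complex.I * (a * ∑ j, e j * (k j : ℂ))) • c (k - K) else 0) =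
        (2 * Real.pi * Complex.I * (a * ∑ j, e j * (k j : ℂ))) • c (k - K) := by
      split_ifs with h
      · rfl
      · rw [hc _ h, smul_zero]
    have h2 : (if k + K ∈ S then (2 * Real.pi * Complex.I * (a' * ∑ j, e j * (k j : ℂ))) • c (k + K) else 0) =
        (2 * Real.pi * Complex.I * (a' * ∑ j, e j * (k j : ℂ))) • c (k + K) := by
      split_ifs with h
      · rfl
      · rw [hc _ h, smul_zero]
    rw [h1, h2, smul_add, smul_smul, smul_smul]
    congr 1 <;> [skip; skip] <;> congr 1 <;> ring
  · intro l _ hl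
    rw [layerCoeff_apply_of_ne hl.1 hl.2]
    split_ifs
    · simp
    · rfl

/-- **The Galerkin field of one Kolmogorov layer** (ladder form):
`V(c)_k = -κ4π²|k|² c k - (2πi ∑ⱼ eⱼ kⱼ) • Π_k (a • c(k - K) + a' • c(k + K))`. [cite: MeshalkinSinai1961, pp. 1700–1705] -/
theorem pvGalerkinField_layer (κ : ℝ) (hK : K ≠ 0) (hKS : K ∈ S) (hKS' : -K ∈ S)
    (he : ∑ j, (K j : ℂ) * e j = 0) (a a' : ℂ) {c : (d → ℤ) → EuclideanSpace ℂ d}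
    (hc : ∀ m, m ∉ S → c m = 0) (k : d → ℤ) :
    pvGalerkinField κ S (fun l => ((if l = K then a else 0) + (if l = -K then a' else 0)) • e) c k =
      -(((κ * (4 * Real.pi ^ 2 * freqNormSq k) : ℝ) : ℂ) • c k) -
        (2 * Real.pi * Complex.I * ∑ j, e j * (k j : ℂ)) • leraySym k (a • c (k - K) + a' • c (k + K)) := by
  rw [pvGalerkinField_def, convectionCoeff_layer hK hKS hKS' he a a' hc k, leraySym_smul]

end Layer

/-! ## §2 Superposition of layers -/

section Superposition

variable {S : Finset (d → ℤ)}

/-- The convection symbol is additive over finite families of carriers. [cite: ConstantinFoias1988, Ch. 8 (8.5)] -/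
theorem convectionCoeff_finset_sum_left {ι : Type*} (s : Finset ι) (β : ι → (d → ℤ) → EuclideanSpace ℂ d)
    (c : (d → ℤ) → EuclideanSpace ℂ d) (k : d → ℤ) :
    convectionCoeff S (fun l => ∑ i ∈ s, β i l) c k = ∑ i ∈ s, convectionCoeff S (β i) c k := by
  classical
  induction s using Finset.induction_on with
  | empty =>
    have h0 : (fun l : d → ℤ => ∑ i ∈ (∅ : Finset ι), β i l) = 0 := by funext l; simp
    rw [h0, convectionCoeff_zero_left, Finset.sum_empty]; rfl
  | insert i s hi ih =>
    have h1 : (fun l : d → ℤ => ∑ i ∈ insert i s, β i l) = β i + fun l => ∑ i ∈ s, β i l := by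
      funext l; rw [Finset.sum_insert hi]; rfl
    rw [h1, convectionCoeff_add_left, ih, Finset.sum_insert hi]

/-- **The convection symbol of a finite real combination of Kolmogorov layers** (a lattice-word cell carrier at a
fixed time: layer `i` has frequency `Kᵢ ≠ 0`, `±Kᵢ ∈ S`, polarisation `eᵢ ⊥ Kᵢ`, amplitudes `aᵢ, a'ᵢ`, weight `rᵢ`):
`convectionCoeff S (∑ᵢ rᵢ βᵢ) c k = ∑ᵢ rᵢ (2πi eᵢ·k) • (aᵢ • c(k - Kᵢ) + a'ᵢ • c(k + Kᵢ))`. [cite: MeshalkinSinai1961, pp. 1700–1705] -/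
theorem convectionCoeff_layers {ι : Type*} (s : Finset ι) {Kf : ι → d → ℤ} {ef : ι → EuclideanSpace ℂ d}
    (hK : ∀ i ∈ s, Kf i ≠ 0) (hKS : ∀ i ∈ s, Kf i ∈ S) (hKS' : ∀ i ∈ s, -Kf i ∈ S)
    (he : ∀ i ∈ s, ∑ j, (Kf i j : ℂ) * ef i j = 0) (af af' r : ι → ℂ)
    {c : (d → ℤ) → EuclideanSpace ℂ d} (hc : ∀ m, m ∉ S → c m = 0) (k : d → ℤ) :
    convectionCoeff S (fun l => ∑ i ∈ s, r i •
        (((if l = Kf i then af i else 0) + (if l = -Kf i then af' i else 0)) • ef i)) c k =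
      ∑ i ∈ s, (r i * (2 * Real.pi * Complex.I * ∑ j, ef i j * (k j : ℂ))) •
        (af i • c (k - Kf i) + af' i • c (k + Kf i)) := by
  rw [convectionCoeff_finset_sum_left]
  refine Finset.sum_congr rfl fun i hi => ?_
  have e1 : (fun l : d → ℤ => r i • (((if l = Kf i then af i else 0) + (if l = -Kf i then af' i else 0)) • ef i)) =
      r i • fun l : d → ℤ => ((if l = Kf i then af i else 0) + (if l = -Kf i then af' i else 0)) • ef i := rfl
  rw [e1, convectionCoeff_smul_left, convectionCoeff_layer (hK i hi) (hKS i hi) (hKS' i hi) (he i hi) _ _ hc,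
    smul_smul]

/-- **The Galerkin field of a finite combination of Kolmogorov layers**: the sum of the layer ladders. [cite: MeshalkinSinai1961, pp. 1700–1705] -/
theorem pvGalerkinField_layers (κ : ℝ) {ι : Type*} (s : Finset ι) {Kf : ι → d → ℤ} {ef : ι → EuclideanSpace ℂ d}
    (hK : ∀ i ∈ s, Kf i ≠ 0) (hKS : ∀ i ∈ s, Kf i ∈ S) (hKS' : ∀ i ∈ s, -Kf i ∈ S)
    (he : ∀ i ∈ s, ∑ j, (Kf i j : ℂ) * ef i j = 0) (af af' r : ι → ℂ)
    {c : (d → ℤ) → EuclideanSpace ℂ d} (hc : ∀ m, m ∉ S → c m = 0) (k : d → ℤ) :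
    pvGalerkinField κ S (fun l => ∑ i ∈ s, r i •
        (((if l = Kf i then af i else 0) + (if l = -Kf i then af' i else 0)) • ef i)) c k =
      -(((κ * (4 * Real.pi ^ 2 * freqNormSq k) : ℝ) : ℂ) • c k) -
        ∑ i ∈ s, (r i * (2 * Real.pi * Complex.I * ∑ j, ef i j * (k j : ℂ))) •
          leraySym k (af i • c (k - Kf i) + af' i • c (k + Kf i)) := by
  rw [pvGalerkinField_def, convectionCoeff_layers s hK hKS hKS' he af af' r hc k]
  congr 1
  rw [← leraySymₗ_apply, map_sum]
  refine Finset.sum_congr rfl fun i _ => ?_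
  rw [map_smul, leraySymₗ_apply]

end Superposition

/-! ## §3 Cosets: the factor `e·k` is constant along `k₀ + ℤK` -/

section Coset

variable {K : d → ℤ} {e : EuclideanSpace ℂ d}

/-- Along the coset `k₀ + ℤK` of a frequency `K ⊥ e` the transversality factor is constant:
`∑ⱼ eⱼ (k₀ + J•K)ⱼ = ∑ⱼ eⱼ (k₀)ⱼ`. [cite: MeshalkinSinai1961, pp. 1700–1705] -/
theorem sum_mul_coset_eq (he : ∑ j, (K j : ℂ) * e j = 0) (k₀ : d → ℤ) (J : ℤ) :
    ∑ j, e j * ((k₀ + J • K) j : ℂ) = ∑ j, e j * (k₀ j : ℂ) := by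
  have h1 : ∑ j, e j * ((k₀ + J • K) j : ℂ) = ∑ j, e j * (k₀ j : ℂ) + (J : ℂ) * ∑ j, (K j : ℂ) * e j := by
    rw [Finset.mul_sum, ← Finset.sum_add_distrib]
    refine Finset.sum_congr rfl fun j _ => ?_
    simp only [Pi.add_apply, Pi.smul_apply, smul_eq_mul, Int.cast_add, Int.cast_mul]
    ring
  rw [h1, he, mul_zero, add_zero]

omit [Fintype d] in
/-- Consecutive points of the coset: `(k₀ + J•K) - K = k₀ + (J-1)•K`. [folklore] -/
private theorem coset_sub (k₀ K : d → ℤ) (J : ℤ) : (k₀ + J • K) - K = k₀ + (J - 1) • K := by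
  rw [sub_smul, one_smul]; abel

omit [Fintype d] in
/-- Consecutive points of the coset: `(k₀ + J•K) + K = k₀ + (J+1)•K`. [folklore] -/
private theorem coset_add (k₀ K : d → ℤ) (J : ℤ) : (k₀ + J • K) + K = k₀ + (J + 1) • K := by
  rw [add_smul, one_smul]; abel

/-- **The ladder along a coset** (one layer): writing `c_J := c(k₀ + J•K)` and `θ := ∑ⱼ eⱼ (k₀)ⱼ`,
`V(c)_{k₀+J•K} = -κ4π²|k₀ + J•K|² c_J - (2πi θ) • Π_{k₀+J•K} (a • c_{J-1} + a' • c_{J+1})`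
— a tridiagonal («three-term») system per coset. [cite: MeshalkinSinai1961, pp. 1700–1705] -/
theorem pvGalerkinField_layer_coset (κ : ℝ) {S : Finset (d → ℤ)} (hK : K ≠ 0) (hKS : K ∈ S) (hKS' : -K ∈ S)
    (he : ∑ j, (K j : ℂ) * e j = 0) (a a' : ℂ) {c : (d → ℤ) → EuclideanSpace ℂ d}
    (hc : ∀ m, m ∉ S → c m = 0) (k₀ : d → ℤ) (J : ℤ) :
    pvGalerkinField κ S (fun l => ((if l = K then a else 0) + (if l = -K then a' else 0)) • e) c (k₀ + J • K) =
      -(((κ * (4 * Real.pi ^ 2 * freqNormSq (k₀ + J • K)) : ℝ) : ℂ) • c (k₀ + J • K)) -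
        (2 * Real.pi * Complex.I * ∑ j, e j * (k₀ j : ℂ)) •
          leraySym (k₀ + J • K) (a • c (k₀ + (J - 1) • K) + a' • c (k₀ + (J + 1) • K)) := by
  rw [pvGalerkinField_layer κ hK hKS hKS' he a a' hc, sum_mul_coset_eq he, coset_sub, coset_add]

end Coset

/-! ## §4 Out-of-plane decoupling: the scalar ladder -/

section Scalar

variable {K : d → ℤ} {e : EuclideanSpace ℂ d}

/-- **The component of the layer field along a direction transversal to `k`** sees no Leray projection:
for `ζ ⊥ k` (`∑ᵢ kᵢ ζᵢ = 0`),
`⟪ζ, V(c)_k⟫ = -κ4π²|k|² ⟪ζ, c k⟫ - (2πi ∑ⱼ eⱼ kⱼ) (a ⟪ζ, c(k-K)⟫ + a' ⟪ζ, c(k+K)⟫)`. [cite: MeshalkinSinai1961, pp. 1700–1705] -/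
theorem inner_pvGalerkinField_layer (κ : ℝ) {S : Finset (d → ℤ)} (hK : K ≠ 0) (hKS : K ∈ S) (hKS' : -K ∈ S)
    (he : ∑ j, (K j : ℂ) * e j = 0) (a a' : ℂ) {c : (d → ℤ) → EuclideanSpace ℂ d}
    (hc : ∀ m, m ∉ S → c m = 0) {k : d → ℤ} {ζ : EuclideanSpace ℂ d} (hζ : ∑ i, (k i : ℂ) * ζ i = 0) :
    inner ℂ ζ (pvGalerkinField κ S (fun l => ((if l = K then a else 0) + (if l = -K then a' else 0)) • e) c k) =
      -(((κ * (4 * Real.pi ^ 2 * freqNormSq k) : ℝ) : ℂ) * inner ℂ ζ (c k)) -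
        (2 * Real.pi * Complex.I * ∑ j, e j * (k j : ℂ)) * (a * inner ℂ ζ (c (k - K)) + a' * inner ℂ ζ (c (k + K))) := by
  rw [pvGalerkinField_layer κ hK hKS hKS' he a a' hc k, inner_sub_right, inner_neg_right, inner_smul_right,
    inner_smul_right, inner_leraySym_right_of_transversal _ _ hζ, inner_add_right, inner_smul_right, inner_smul_right]

/-- **The exact scalar ladder of the out-of-plane polarisation.** If `ζ ⊥ k₀` and `ζ ⊥ K`, then `ζ` is transversal to
every point of the coset `k₀ + ℤK`, and the components `u_J := ⟪ζ, c(k₀ + J•K)⟫` obey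
`⟪ζ, V(c)_{k₀+J•K}⟫ = -κ4π²|k₀+J•K|² u_J - (2πi θ)(a u_{J-1} + a' u_{J+1})`, `θ = ∑ⱼ eⱼ (k₀)ⱼ`
(no Leray projection: the scalar passive-transport ladder of Meshalkin–Sinai). [cite: MeshalkinSinai1961, pp. 1700–1705] -/
theorem inner_pvGalerkinField_layer_coset (κ : ℝ) {S : Finset (d → ℤ)} (hK : K ≠ 0) (hKS : K ∈ S) (hKS' : -K ∈ S)
    (he : ∑ j, (K j : ℂ) * e j = 0) (a a' : ℂ) {c : (d → ℤ) → EuclideanSpace ℂ d}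
    (hc : ∀ m, m ∉ S → c m = 0) {k₀ : d → ℤ} {ζ : EuclideanSpace ℂ d} (hζ₀ : ∑ i, (k₀ i : ℂ) * ζ i = 0)
    (hζK : ∑ i, (K i : ℂ) * ζ i = 0) (J : ℤ) :
    inner ℂ ζ (pvGalerkinField κ S (fun l => ((if l = K then a else 0) + (if l = -K then a' else 0)) • e) c (k₀ + J • K)) =
      -(((κ * (4 * Real.pi ^ 2 * freqNormSq (k₀ + J • K)) : ℝ) : ℂ) * inner ℂ ζ (c (k₀ + J • K))) -
        (2 * Real.pi * Complex.I * ∑ j, e j * (k₀ j : ℂ)) *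
          (a * inner ℂ ζ (c (k₀ + (J - 1) • K)) + a' * inner ℂ ζ (c (k₀ + (J + 1) • K))) := by
  have hζ : ∑ i, ((k₀ + J • K) i : ℂ) * ζ i = 0 := by
    have h1 : ∑ i, ((k₀ + J • K) i : ℂ) * ζ i = ∑ i, (k₀ i : ℂ) * ζ i + (J : ℂ) * ∑ i, (K i : ℂ) * ζ i := by
      rw [Finset.mul_sum, ← Finset.sum_add_distrib]
      refine Finset.sum_congr rfl fun i _ => ?_
      simp only [Pi.add_apply, Pi.smul_apply, smul_eq_mul, Int.cast_add, Int.cast_mul]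
      ring
    rw [h1, hζ₀, hζK, mul_zero, add_zero]
  rw [inner_pvGalerkinField_layer κ hK hKS hKS' he a a' hc hζ, sum_mul_coset_eq he, coset_sub, coset_add]

end Scalar

end Torus

end Literature.Analysis.FluidPDE
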